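import Literature.Geometry.GeometricMeasureTheory.MassComplete
import Literature.Geometry.GeometricMeasureTheory.ApproxTangentChart
import HarnessLib

/-!
# Integral currents of dimension zero: finite sums of integer point masses

Federer [Federer1969, 4.1.24–4.1.28]: `𝐈_0(U) = 𝓡_0(U)`, and a `0`-dimensional rectifiable current
with compact support is a finite sum of point masses with integer multiplicities (cf. 4.1.25:
"`𝒫_{0,K}(ℝⁿ) = 𝓡_{0,K}(ℝⁿ) = 𝐈_{0,K}(ℝⁿ)`", the integral polyhedral `0`-chains being the finite
integral combinations of the point masses `δ_x = [x]`). For the currents of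
`Literature.Geometry.GeometricMeasureTheory.Currents` (class `Current.IsRectifiable`, defined through
the integral representation 4.1.28 (4) with the Euclidean Hausdorff measure `𝓗^0 = μHE[0]`, the
counting measure) this file proves that description, in the canonical form
`[F, n] = currentOfIntegration ↑F n (fun _ => ![])` — "`Σ_{x ∈ F} n(x) δ_x`" — for a FINITE
carrier `F : Finset V` and a multiplicity `n : V → ℤ`:

* `finite_of_euclideanHausdorffMeasure_zero_ne_top` — `𝓗^0(S) < ∞ ⟹ S` finite;
  `setIntegral_finset_euclideanHausdorffMeasure_zero` — `∫_F f d𝓗^0 = Σ_{x ∈ F} f(x)`;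
* `currentOfIntegration_finset_apply` — `[F, n](φ) = Σ_{x ∈ F} n(x) φ(x)` (the `0`-covector
  `φ(x)` evaluated on the empty frame);
* `approxTangentCone_zero_restrict_finset` — `Tan^0(𝓗^0 ⌞ F, x) = {0}` for `x ∈ F`, whence
  `isRectifiableData_finset` and **`isRectifiable_currentOfIntegration_finset`**: `[F, n] ∈ 𝓡_0(V)`
  (`= 𝐈_0(V)`);
* `mass_currentOfIntegration_finset` — `𝐌([F, n]) = Σ_{x ∈ F} |n(x)|`;
* **`Current.IsRectifiable.exists_finset_eq_currentOfIntegration`** — every `T ∈ 𝓡_0(V)` is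
  `[F, n]` for a finite `F ⊆ spt T` and a multiplicity `n` with `𝐌(T) = Σ_{x ∈ F} |n(x)|`.

Theorems only; no definitions, no named facts.

## References

* H. Federer, *Geometric Measure Theory*, Grundlehren 153, Springer 1969, 2.10.2, 2.10.19, 3.2.14,
  3.2.16, 4.1.24, 4.1.25, 4.1.28 [Federer1969].
-/

noncomputable section

open scoped ENNReal NNReal Topology
open MeasureTheory MeasureTheory.Measure TopologicalSpace Set Filter Metric Function

namespace Literature.Geometry.GeometricMeasureTheory

set_option maxSynthPendingDepth 2

variable {V : Type*} [NormedAddCommGroup V] [InnerProductSpace ℝ V] [FiniteDimensional ℝ V]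
  [MeasurableSpace V] [BorelSpace V]

/-! ### `𝓗^0` on finite sets -/

section HausdorffZero

omit [InnerProductSpace ℝ V] [FiniteDimensional ℝ V] in
/-- `𝓗^0({x}) = 1` for the Euclidean-normalised Hausdorff measure. [cite: Federer1969, 2.10.2] -/
@[simp] theorem euclideanHausdorffMeasure_zero_singleton (x : V) :
    (μHE[0] : Measure V) {x} = 1 := by
  rw [euclideanHausdorffMeasure_zero, hausdorffMeasure_zero_singleton]

omit [InnerProductSpace ℝ V] [FiniteDimensional ℝ V] in
/-- `𝓗^0(F) = #F` for a finite set `F` (`𝓗^0` is the counting measure). [cite: Federer1969, 2.10.2] -/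
theorem euclideanHausdorffMeasure_zero_finset (F : Finset V) :
    (μHE[0] : Measure V) ↑F = F.card := by
  rw [← sum_measure_singleton (μ := (μHE[0] : Measure V)) (s := F)]
  simp

omit [InnerProductSpace ℝ V] [FiniteDimensional ℝ V] in
/-- A set of finite `𝓗^0`-measure is finite. [cite: Federer1969, 2.10.2] -/
theorem finite_of_euclideanHausdorffMeasure_zero_ne_top {S : Set V}
    (h : (μHE[0] : Measure V) S ≠ ⊤) : S.Finite := by
  by_contra hS
  apply h
  refine ENNReal.eq_top_of_forall_nnreal_le fun r => ?_
  obtain ⟨n, hn⟩ := exists_nat_gt (r : ℝ)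
  obtain ⟨t, htS, htc⟩ := Set.Infinite.exists_subset_card_eq hS n
  calc (r : ℝ≥0∞) ≤ n := by exact_mod_cast hn.le
    _ = (μHE[0] : Measure V) ↑t := by rw [euclideanHausdorffMeasure_zero_finset, htc]
    _ ≤ (μHE[0] : Measure V) S := measure_mono htS

omit [InnerProductSpace ℝ V] [FiniteDimensional ℝ V] in
/-- Every function is `𝓗^0`-integrable on a finite set (`𝓗^0` is the counting measure).
[cite: Federer1969, 2.10.2] -/
theorem integrableOn_finset_euclideanHausdorffMeasure_zero {E : Type*} [NormedAddCommGroup E]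
    (F : Finset V) (f : V → E) : IntegrableOn f ↑F (μHE[0] : Measure V) := by
  rw [← (F : Set V).biUnion_of_singleton]
  simp only [Finset.mem_coe, integrableOn_finset_iUnion]
  exact fun x _ => integrableOn_singleton (by simp) (by simp)

omit [InnerProductSpace ℝ V] [FiniteDimensional ℝ V] in
/-- `∫_F f d𝓗^0 = Σ_{x ∈ F} f(x)`. [cite: Federer1969, 2.10.2] -/
theorem setIntegral_finset_euclideanHausdorffMeasure_zero {E : Type*} [NormedAddCommGroup E]
    [NormedSpace ℝ E] [CompleteSpace E] (F : Finset V) (f : V → E) :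
    ∫ x in ↑F, f x ∂(μHE[0] : Measure V) = ∑ x ∈ F, f x := by
  rw [setIntegral_finset F (integrableOn_finset_euclideanHausdorffMeasure_zero F f)]
  refine Finset.sum_congr rfl fun x _ => ?_
  rw [measureReal_def, euclideanHausdorffMeasure_zero_singleton, ENNReal.toReal_one, one_smul]

omit [InnerProductSpace ℝ V] [FiniteDimensional ℝ V] in
/-- `∫⁻_F f d𝓗^0 = Σ_{x ∈ F} f(x)`. [cite: Federer1969, 2.10.2] -/
theorem setLIntegral_finset_euclideanHausdorffMeasure_zero (F : Finset V) (f : V → ℝ≥0∞) :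
    ∫⁻ x in ↑F, f x ∂(μHE[0] : Measure V) = ∑ x ∈ F, f x := by
  rw [lintegral_finset]
  exact Finset.sum_congr rfl fun x _ => by rw [euclideanHausdorffMeasure_zero_singleton, mul_one]

end HausdorffZero

/-! ### The finite `0`-chains `[F, n] = Σ_{x ∈ F} n(x) δ_x` -/

section Chains

variable {Ω : Opens V}

omit [FiniteDimensional ℝ V] [MeasurableSpace V] [BorelSpace V] in
/-- The empty frame is orthonormal. [folklore] -/
private theorem orthonormal_vecEmpty : Orthonormal ℝ (![] : Fin 0 → V) :=
  ⟨fun i => i.elim0, fun i => i.elim0⟩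

omit [FiniteDimensional ℝ V] in
/-- The density `x ↦ n(x) · (empty frame)` is `𝓗^0 ⌞ F`-integrable on a finite `F`. [folklore] -/
private theorem integrable_density_finset (F : Finset V) (n : V → ℤ) :
    Integrable (fun x => (n x : ℝ) • frameVector (![] : Fin 0 → V))
      ((μHE[0] : Measure V).restrict ↑F) :=
  integrableOn_finset_euclideanHausdorffMeasure_zero F _

omit [FiniteDimensional ℝ V] in
/-- Local integrability of the density of `[F, n]`, as required by `IsRectifiableData`.
[cite: Federer1969, 4.1.28 (4)] -/
theorem locallyIntegrableOn_density_finset (F : Finset V) (n : V → ℤ) :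
    LocallyIntegrableOn (fun x => (n x : ℝ) • frameVector ((fun _ => (![] : Fin 0 → V)) x))
      (Ω : Set V) ((μHE[0] : Measure V).restrict ↑F) :=
  (integrable_density_finset F n).locallyIntegrable.locallyIntegrableOn _

omit [FiniteDimensional ℝ V] in
/-- **`[F, n](φ) = Σ_{x ∈ F} n(x) φ(x)`**: the finite `0`-chain evaluates a test `0`-form by summing
its values (on the empty frame) with multiplicities. [cite: Federer1969, 4.1.25, 4.1.28] -/
theorem currentOfIntegration_finset_apply (F : Finset V) (n : V → ℤ) (φ : TestForm Ω 0) :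
    (currentOfIntegration ↑F n (fun _ => ![]) : Current Ω 0) φ = ∑ x ∈ F, (n x : ℝ) * φ x ![] := by
  rw [currentOfIntegration_apply (locallyIntegrableOn_density_finset F n),
    setIntegral_finset_euclideanHausdorffMeasure_zero]

omit [FiniteDimensional ℝ V] in
/-- The frame of a `0`-current of integration is immaterial: all frames `Fin 0 → V` coincide
(the `0`-vector `ξ₁ ∧ ⋯ ∧ ξ₀ = 1`). [cite: Federer1969, 4.1.28 (4)] -/
theorem currentOfIntegration_zero_frame_eq (W : Set V) (θ : V → ℤ) (ξ : V → Fin 0 → V) :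
    (currentOfIntegration W θ ξ : Current Ω 0) = currentOfIntegration W θ fun _ => ![] := by
  have : ξ = fun _ => ![] := funext fun x => Subsingleton.elim _ _
  rw [this]

end Chains

/-! ### Rectifiability of the finite `0`-chains -/

section Rectifiable

variable {Ω : Opens V}

omit [InnerProductSpace ℝ V] [FiniteDimensional ℝ V] in
/-- Countable sets are countably `0`-rectifiable (each point is the image of the constant map from
`ℝ^0`). [cite: Federer1969, 3.2.14] -/
theorem isCountablyRectifiable_zero_of_countable {W : Set V} (hW : W.Countable) :
    IsCountablyRectifiable 0 W := by
  rcases W.eq_empty_or_nonempty with rfl | hne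
  · exact isCountablyRectifiable_empty
  obtain ⟨f, hf⟩ := hW.exists_eq_range hne
  refine ⟨fun i _ => f i, fun i => ⟨0, LipschitzWith.const (f i)⟩, ?_⟩
  have : W \ ⋃ i, range (fun _ : EuclideanSpace ℝ (Fin 0) => f i) = ∅ := by
    refine Set.eq_empty_of_forall_notMem fun x hx => hx.2 ?_
    obtain ⟨i, hi⟩ : ∃ i, f i = x := by rw [hf] at hx; exact hx.1
    exact mem_iUnion.2 ⟨i, ⟨0, hi⟩⟩
  rw [this, measure_empty]

omit [FiniteDimensional ℝ V] [MeasurableSpace V] [BorelSpace V] in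
/-- The tangent cone of a point is trivial: `Tan({x}, x) ⊆ {0}` (a point is not an accumulation
point of itself). [cite: Federer1969, 3.1.21] -/
theorem posTangentConeAt_singleton_subset (x : V) : posTangentConeAt ({x} : Set V) x ⊆ {0} := by
  have h : ¬AccPt x (𝓟 ({x} : Set V)) := by
    rw [accPt_principal_iff_nhdsWithin, Set.sdiff_self, nhdsWithin_empty]
    exact fun hb => hb.ne rfl
  rw [Set.singleton_zero]
  exact tangentConeAt_subset_zero h

/-- **The approximate tangent cone of `𝓗^0 ⌞ F` at a point of the finite set `F` is `{0}`.** The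
sets `S` of density zero complement all contain `x` (the complement of such an `S` has
`(𝓗^0 ⌞ F)`-measure `≥ 1` on every ball around `x` otherwise), so `0 ∈ Tan^0`; and `Tan^0 ⊆ Tan(F ∩ U, x)`
for the neighbourhood `U = (F ∖ {x})ᶜ` of `x`, with `F ∩ U = {x}`. [cite: Federer1969, 3.2.16] -/
theorem approxTangentCone_zero_restrict_finset (F : Finset V) {x : V} (hx : x ∈ F) :
    approxTangentCone 0 ((μHE[0] : Measure V).restrict ↑F) x = {0} := by
  classical
  refine Subset.antisymm ?_ ?_
  · -- `⊆`: localise to `U = (F.erase x)ᶜ`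
    set U : Set V := (↑(F.erase x) : Set V)ᶜ with hU
    have hUo : IsOpen U := (F.erase x).finite_toSet.isClosed.isOpen_compl
    have hxU : x ∈ U := by simp [hU]
    have hFU : (↑F : Set V) ∩ U = {x} := by
      ext y
      simp only [hU, mem_inter_iff, Finset.mem_coe, mem_compl_iff, Finset.mem_erase, ne_eq,
        not_and, mem_singleton_iff]
      constructor
      · rintro ⟨hyF, h⟩
        by_contra hyx
        exact h hyx hyF
      · rintro rfl; exact ⟨hx, fun h _ => h rfl⟩
    refine (approxTangentCone_restrict_subset_posTangentConeAt _ F.measurableSet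
      hUo.measurableSet (hUo.mem_nhds hxU)).trans ?_
    rw [hFU]
    exact posTangentConeAt_singleton_subset x
  · -- `⊇`: every admissible `S` contains `x`
    rintro y hy
    rw [mem_singleton_iff] at hy
    subst hy
    refine mem_iInter₂.2 fun S hS => zero_mem_tangentConeAt (subset_closure (?_ : x ∈ S))
    by_contra hxS
    -- otherwise every closed ball around `x` has `((𝓗^0 ⌞ F) ⌞ Sᶜ)`-measure `≥ 1`
    set ν : Measure V := (((μHE[0] : Measure V).restrict ↑F).restrict Sᶜ) with hν
    have hge : ∀ᶠ r in 𝓝[>] (0 : ℝ),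
        1 / unitBallVolume 0 ≤ ν (closedBall x r) / (unitBallVolume 0 * ENNReal.ofReal (r ^ 0)) := by
      filter_upwards [self_mem_nhdsWithin] with r hr
      rw [pow_zero, ENNReal.ofReal_one, mul_one]
      refine ENNReal.div_le_div_right ?_ _
      calc (1 : ℝ≥0∞) = (μHE[0] : Measure V) {x} := (euclideanHausdorffMeasure_zero_singleton x).symm
        _ ≤ (μHE[0] : Measure V) ((closedBall x r ∩ Sᶜ) ∩ ↑F) :=
            measure_mono (singleton_subset_iff.2 ⟨⟨mem_closedBall_self (le_of_lt hr), hxS⟩, hx⟩)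
        _ ≤ ((μHE[0] : Measure V).restrict ↑F) (closedBall x r ∩ Sᶜ) := le_restrict_apply _ _
        _ ≤ ν (closedBall x r) := le_restrict_apply _ _
    have h0 : 1 / unitBallVolume 0 ≤ (0 : ℝ≥0∞) :=
      ge_of_tendsto (tendsto_of_upperDensity_eq_zero hS) hge
    rw [nonpos_iff_eq_zero, ENNReal.div_eq_zero_iff] at h0
    exact h0.elim one_ne_zero (unitBallVolume_ne_top 0)

/-- **Admissible data on a finite carrier**: `[F, n]` with the empty frame satisfies Federer's
4.1.28 (4) conditions in dimension `0`. [cite: Federer1969, 4.1.28 (4)] -/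
theorem isRectifiableData_finset (F : Finset V) (n : V → ℤ) (hF : (↑F : Set V) ⊆ Ω) :
    IsRectifiableData Ω 0 ↑F n (fun _ => ![]) := by
  refine ⟨F.measurableSet, hF, isCountablyRectifiable_zero_of_countable F.countable_toSet,
    locallyIntegrableOn_density_finset F n, ?_⟩
  refine ae_restrict_of_forall_mem F.measurableSet fun x hx => ⟨orthonormal_vecEmpty, ?_⟩
  rw [approxTangentCone_zero_restrict_finset F hx, Set.range_eq_empty, Submodule.span_empty,
    Submodule.bot_coe]

/-- **The finite `0`-chains are rectifiable currents**: `[F, n] = Σ_{x ∈ F} n(x) δ_x ∈ 𝓡_0(Ω)`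
(`= 𝐈_0(Ω)`) for every finite `F ⊆ Ω` and every multiplicity `n`. [cite: Federer1969, 4.1.25, 4.1.28] -/
theorem isRectifiable_currentOfIntegration_finset (F : Finset V) (n : V → ℤ)
    (hF : (↑F : Set V) ⊆ Ω) :
    (currentOfIntegration ↑F n (fun _ => ![]) : Current Ω 0).IsRectifiable :=
  ⟨⟨_, _, _, isRectifiableData_finset F n hF, rfl⟩,
    Current.isCompact_support_of_subset _ F.finite_toSet.isCompact hF
      ((support_currentOfIntegration_subset_closure _ _ _).trans
        F.finite_toSet.isClosed.closure_subset)⟩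

/-- `𝐈_0 = 𝓡_0`: the finite `0`-chains are integral currents. [cite: Federer1969, 4.1.24] -/
theorem isIntegral_currentOfIntegration_finset (F : Finset V) (n : V → ℤ)
    (hF : (↑F : Set V) ⊆ Ω) :
    (currentOfIntegration ↑F n (fun _ => ![]) : Current Ω 0).IsIntegral :=
  isRectifiable_currentOfIntegration_finset F n hF

end Rectifiable

/-! ### Mass, and the representation of `𝓡_0(V)` -/

section Mass

/-- **`𝐌([F, n]) = Σ_{x ∈ F} |n(x)|`** ("`‖μ ∧ η‖ = μ ⌞ |η|`", the empty frame having unit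
`0`-vector). [cite: Federer1969, 4.1.7, 4.1.28] -/
theorem mass_currentOfIntegration_finset (F : Finset V) (n : V → ℤ) :
    (currentOfIntegration ↑F n (fun _ => ![]) : Current (⊤ : Opens V) 0).mass =
      ∑ x ∈ F, ((n x).natAbs : ℝ≥0∞) := by
  unfold currentOfIntegration
  rw [mass_vectorCurrent_eq_lintegral (locallyIntegrableOn_density_finset F n),
    setLIntegral_finset_euclideanHausdorffMeasure_zero]
  refine Finset.sum_congr rfl fun x _ => ?_
  rw [enorm_smul, show ‖frameVector (![] : Fin 0 → V)‖ₑ = 1 by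
    rw [← ofReal_norm, norm_frameVector_eq_one orthonormal_vecEmpty, ENNReal.ofReal_one],
    mul_one, ← ofReal_norm, Real.norm_eq_abs, ← Int.cast_abs, Int.abs_eq_natAbs,
    Int.cast_natCast, ENNReal.ofReal_natCast]

/-- **Every `T ∈ 𝓡_0(V)` is a finite `0`-chain `[F, n]`** with `F ⊆ spt T` and
`𝐌(T) = Σ_{x ∈ F} |n(x)|`: the normalised data of `T` carried by the compact `spt T` have finite
`𝓗^0`-measure (`Current.IsRectifiable.exists_data_subset`), i.e. a finite carrier.
[cite: Federer1969, 4.1.25, 4.1.28 (4)] -/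
theorem Current.IsRectifiable.exists_finset_eq_currentOfIntegration {T : Current (⊤ : Opens V) 0}
    (hT : T.IsRectifiable) :
    ∃ (F : Finset V) (n : V → ℤ), (↑F : Set V) ⊆ T.support ∧
      T = currentOfIntegration ↑F n (fun _ => ![]) ∧ T.mass = ∑ x ∈ F, ((n x).natAbs : ℝ≥0∞) := by
  obtain ⟨W, θ, ξ, -, hTW, hWK, hWfin, -⟩ := hT.exists_data_subset hT.2 Subset.rfl
  obtain ⟨F, rfl⟩ := (finite_of_euclideanHausdorffMeasure_zero_ne_top hWfin.ne).exists_finset_coe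
  refine ⟨F, θ, hWK, ?_, ?_⟩
  · rw [hTW, currentOfIntegration_zero_frame_eq]
  · rw [hTW, currentOfIntegration_zero_frame_eq, mass_currentOfIntegration_finset]

end Mass

end Literature.Geometry.GeometricMeasureTheory
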